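import Summits.QuantumFields.YangMills.Theorems.BalabanUVNodesPortU2Dom44JGauge

/-!
# PORT helper DRAFT (PT-C lineage, helper mode; NOT FILED — custody of new record-side OBJECTS is DEF-1's ∕ CRIT-1's) —
# THE (Φ2) CARRIER: X's cut coordinate space NORMED BY THE GAUGE of print's (4.4)∕(1.14) domain, so that `ball 0 α₂` IS `recordDom44J X α₂`

CRIT-1 RULING (Φ2) (nodeO STATUS 2026-08-30T23:48Z): «the record instance takes `Wn n X :=` X's cut coordinate space normed by `α₂ · gauge (D n X)`
(so `ball 0 α₂ = D n X`) … then `han`∕`h118` ARE `Chart44D`'s rows and `hh` IS `Response9D` (R1ᴰ) VERBATIM with `B₃ := α₂·C₉`».  This draft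
realises that carrier over DEF-1's names with the gauge toolkit ✓p797390 (`…PortU2Dom44JGauge`), in the tree's house pattern for «the (4.4)-set is the open
α₂-ball of a normed configuration space» (`Literature/…/B12Eq44Ball.lean`: `Cfg44` = a submodule re-normed by `seminorm44` via `NormedSpace.Core`, `incl`,
`mem_ball_zero_iff`, `analyticOnNhd_comp_incl` — there over bond functions at the flat background with print's `P₁` letter; here over the record's two-block
chart coordinates, normed by the GAUGE so that no seminorm is re-declared):
* `cutSubmodule F Mc k K X` — the vectors supported on `recordCXJ X`; `Dom44JCut F Mc k K X` — a TYPE SYNONYM of it (so that the ambient sup norm is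
  NOT inherited), with `AddCommGroup ∕ Module ℂ` transported and the norm `‖w‖ := gauge (recordDom44J F Mc k K X 1) w` (= `α₂ · gauge (recordDom44J … α₂) w`
  for every `α₂ > 0`, `gauge_recordDom44J_eq_inv_mul`); `NormedAddCommGroup ∕ NormedSpace ℂ` by `NormedAddCommGroup.ofCore` (definiteness =
  `cutTo_eq_zero_of_gauge_eq_zero`, homogeneity = `gauge_recordDom44J_smul_eq`, triangle = `gauge_recordDom44J_add_le`).
* ★ `Dom44JCut.mem_ball_zero_iff` ∕ `ball_zero_eq_preimage`: `ball 0 α₂ = val ⁻¹' recordDom44J … X α₂` (`0 < α₂`).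
* `Dom44JCut.valCLM` (the inclusion, a continuous linear map of norm ≤ 1 into the sup-normed chart space), `Dom44JCut.cut` (`u ↦ cutTo (recordCXJ X) u` as an
  element), ★ `norm_cut_eq` (`‖cut u‖ = α₂ · gauge (recordDom44J … α₂) (cutTo (recordCXJ X) u)` — so (R1ᴰ) `gauge ≤ C₉e^{−δ₀dist}` reads `‖hn‖ ≤ α₂C₉e^{−δ₀dist}`),
  ★ `analyticOnNhd_comp_valCLM` (a function analytic on the (4.4) domain is analytic on the carrier's α₂-ball, jointly with a coupling parameter).
HONEST FRAMING.  A normed-space packaging of a NAMED SET; nothing of Bałaban asserted, ported or discharged; DRAFT for DEF-1 ∕ CRIT-1 ∕ the port lead to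
place (names edition, `…Defs`, or this seat's file on their word); finite `𝕋⁴_{L^K}` at fixed ε — NOT continuum ∕ OS ∕ Clay; **the Yang–Mills mass gap is NOT proved.**
-/

noncomputable section

open scoped BigOperators Matrix.Norms.L2Operator Topology Pointwise

namespace Summit.QuantumFields.YangMills.Theorems.PortU2

open Literature.MathematicalPhysics.QuantumFieldTheory.Balaban1983to89
open Literature.MathematicalPhysics.QuantumFieldTheory.Balaban1983to89.Node00
open Literature.MathematicalPhysics.QuantumFieldTheory.Balaban1983to89.T4Continuum (T4Family)
open Summit.QuantumFields.YangMills.Theorems.K0RecordFormatNames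
open B12FormatPlus (cutTo cutTo_apply)

variable (F : T4Family)

/-! ## §1  The cut coordinate submodule of `X` -/

/-- **`cutSubmodule F Mc k K X`** — the chart coordinates supported on the bonds of `X` (the range of `cutTo (recordCXJ X)`).
[cite: Balaban1987RG1, (1.7) p.261, (4.35) p.290 (bookkeeping)] -/
def cutSubmodule (Mc k K : ℕ) (X : (recordDomSys F Mc k K).Dom) : Submodule ℂ (Fin (recordChartDimJ F K) → ℂ) where
  carrier := {w | ∀ i, i ∉ recordCXJ F Mc k K X → w i = 0}
  add_mem' {w w'} hw hw' := fun i hi => by simp [hw i hi, hw' i hi]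
  zero_mem' := fun i _ => rfl
  smul_mem' c {w} hw := fun i hi => by simp [hw i hi]

/-- Membership in the cut submodule, unfolded. [cite: Balaban1987RG1, (1.7) p.261 (bookkeeping)] -/
theorem mem_cutSubmodule_iff (Mc k K : ℕ) (X : (recordDomSys F Mc k K).Dom) (w : Fin (recordChartDimJ F K) → ℂ) :
    w ∈ cutSubmodule F Mc k K X ↔ ∀ i, i ∉ recordCXJ F Mc k K X → w i = 0 := Iff.rfl

/-- `cutTo (recordCXJ X) u` lies in the cut submodule. [cite: Balaban1987RG1, (4.35) p.290 (bookkeeping)] -/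
theorem cutTo_mem_cutSubmodule (Mc k K : ℕ) (X : (recordDomSys F Mc k K).Dom) (u : Fin (recordChartDimJ F K) → ℂ) :
    cutTo (recordCXJ F Mc k K X) u ∈ cutSubmodule F Mc k K X := fun i hi => by
  simp [cutTo_apply, hi]

/-- On the cut submodule `cutTo` is the identity. [cite: Balaban1987RG1, (4.35) p.290 (bookkeeping)] -/
theorem cutTo_eq_self_of_mem (Mc k K : ℕ) (X : (recordDomSys F Mc k K).Dom) {w : Fin (recordChartDimJ F K) → ℂ}
    (hw : w ∈ cutSubmodule F Mc k K X) : cutTo (recordCXJ F Mc k K X) w = w := by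
  ext i
  rw [cutTo_apply]
  split_ifs with hi
  · rfl
  · exact (hw i hi).symm

/-! ## §2  The carrier type and its gauge norm -/

/-- **`Dom44JCut F Mc k K X`** — THE (Φ2) CARRIER: X's cut coordinate space as a type of its own (the ambient sup norm is deliberately NOT
inherited; the norm below is the gauge of print's (4.4)∕(1.14) domain). [cite: Balaban1987RG1, (4.4) p.281, (1.14) p.262] -/
def Dom44JCut (Mc k K : ℕ) (X : (recordDomSys F Mc k K).Dom) : Type := ↥(cutSubmodule F Mc k K X)

namespace Dom44JCut

variable {F} {Mc k K : ℕ} {X : (recordDomSys F Mc k K).Dom}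

/-- The additive group structure, transported from the cut submodule. [folklore] -/
instance instAddCommGroup : AddCommGroup (Dom44JCut F Mc k K X) := inferInstanceAs (AddCommGroup ↥(cutSubmodule F Mc k K X))

/-- The `ℂ`-module structure, transported from the cut submodule. [folklore] -/
instance instModule : Module ℂ (Dom44JCut F Mc k K X) := inferInstanceAs (Module ℂ ↥(cutSubmodule F Mc k K X))

/-- The inclusion into the full two-block chart space. [cite: Balaban1987RG1, (1.7) p.261 (bookkeeping)] -/
def val (w : Dom44JCut F Mc k K X) : Fin (recordChartDimJ F K) → ℂ := (show ↥(cutSubmodule F Mc k K X) from w).1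

/-- The inclusion is injective. [cite: Balaban1987RG1, (1.7) p.261 (bookkeeping)] -/
theorem val_injective : Function.Injective (val : Dom44JCut F Mc k K X → Fin (recordChartDimJ F K) → ℂ) :=
  fun _ _ h => Subtype.ext h

/-- The inclusion lands in the cut submodule. [cite: Balaban1987RG1, (1.7) p.261 (bookkeeping)] -/
theorem val_mem (w : Dom44JCut F Mc k K X) : val w ∈ cutSubmodule F Mc k K X := (show ↥(cutSubmodule F Mc k K X) from w).2

/-- `cutTo` fixes the included vector. [cite: Balaban1987RG1, (4.35) p.290 (bookkeeping)] -/
theorem cutTo_val (w : Dom44JCut F Mc k K X) : cutTo (recordCXJ F Mc k K X) (val w) = val w := cutTo_eq_self_of_mem F Mc k K X (val_mem w)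

/-- `val` is additive. [folklore] -/
@[simp] theorem val_add (w w' : Dom44JCut F Mc k K X) : val (w + w') = val w + val w' := rfl
/-- `val` commutes with scalars. [folklore] -/
@[simp] theorem val_smul (c : ℂ) (w : Dom44JCut F Mc k K X) : val (c • w) = c • val w := rfl
/-- `val 0 = 0`. [folklore] -/
@[simp] theorem val_zero : val (0 : Dom44JCut F Mc k K X) = 0 := rfl
/-- `val` commutes with negation. [folklore] -/
@[simp] theorem val_neg (w : Dom44JCut F Mc k K X) : val (-w) = -val w := rfl
/-- `val` commutes with subtraction. [folklore] -/
@[simp] theorem val_sub (w w' : Dom44JCut F Mc k K X) : val (w - w') = val w - val w' := rfl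

/-- `val` as a `ℂ`-linear map. [cite: Balaban1987RG1, (1.7) p.261 (bookkeeping)] -/
def valₗ : Dom44JCut F Mc k K X →ₗ[ℂ] (Fin (recordChartDimJ F K) → ℂ) where
  toFun := val
  map_add' := val_add
  map_smul' := val_smul

/-- `valₗ` evaluates to `val`. [folklore] -/
@[simp] theorem valₗ_apply (w : Dom44JCut F Mc k K X) : valₗ w = val w := rfl

/-- **THE NORM OF THE CARRIER := the gauge of `recordDom44J … X 1`** at the included vector. [cite: Balaban1987RG1, (4.4) p.281, (1.14) p.262] -/
instance instNorm : Norm (Dom44JCut F Mc k K X) := ⟨fun w => gauge (recordDom44J F Mc k K X 1) (val w)⟩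

/-- The norm, unfolded. [cite: Balaban1987RG1, (4.4) p.281 (bookkeeping)] -/
theorem norm_def (w : Dom44JCut F Mc k K X) : ‖w‖ = gauge (recordDom44J F Mc k K X 1) (val w) := rfl

/-- The normed-space core: homogeneity (balanced), triangle (convex + absorbent), definiteness ON THE CUT SPACE. [cite: Balaban1987RG1, (4.4) p.281 (bookkeeping)] -/
theorem normedSpaceCore : NormedSpace.Core ℂ (Dom44JCut F Mc k K X) where
  norm_nonneg w := gauge_nonneg _
  norm_smul c w := by rw [norm_def, norm_def, val_smul, gauge_recordDom44J_smul_eq]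
  norm_triangle w w' := by rw [norm_def, norm_def, norm_def, val_add]; exact gauge_recordDom44J_add_le F Mc k K X one_pos _ _
  norm_eq_zero_iff w := by
    refine ⟨fun h => ?_, fun h => by rw [h, norm_def, val_zero, gauge_zero]⟩
    rw [norm_def, ← cutTo_val] at h
    have h0 := cutTo_eq_zero_of_gauge_eq_zero F Mc k K X one_pos (val w) h
    rw [cutTo_val] at h0
    exact val_injective (by rw [h0, val_zero])

/-- **The carrier is a normed group under the gauge norm.** [cite: Balaban1987RG1, (4.4) p.281 (bookkeeping)] -/
instance instNormedAddCommGroup : NormedAddCommGroup (Dom44JCut F Mc k K X) := NormedAddCommGroup.ofCore normedSpaceCore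

/-- **The carrier is a complex normed space under the gauge norm.** [cite: Balaban1987RG1, (4.4) p.281 (bookkeeping)] -/
instance instNormedSpace : NormedSpace ℂ (Dom44JCut F Mc k K X) := NormedSpace.ofCore normedSpaceCore

/-! ## §3  `ball 0 α₂` IS print's (4.4)∕(1.14) domain; the inclusion is continuous; `cutTo` as an element; analyticity transport -/

/-- **THE NORM IN α₂-CURRENCY**: `‖w‖ = α₂ · gauge (recordDom44J … X α₂) (val w)` for every `0 < α₂`. [cite: Balaban1987RG1, (4.4) p.281 (bookkeeping)] -/
theorem norm_eq_mul_gauge {α₂ : ℝ} (hα : 0 < α₂) (w : Dom44JCut F Mc k K X) :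
    ‖w‖ = α₂ * gauge (recordDom44J F Mc k K X α₂) (val w) := by
  rw [norm_def, gauge_recordDom44J_eq_inv_mul F Mc k K X hα, ← mul_assoc, mul_inv_cancel₀ hα.ne', one_mul]

/-- ★ **`w ∈ ball 0 α₂ ↔ val w ∈ recordDom44J … X α₂`** (`0 < α₂`): the carrier's α₂-ball IS print's (4.4)∕(1.14) domain on the cut space.
[cite: Balaban1987RG1, (4.4) p.281, (1.14) p.262] -/
theorem mem_ball_zero_iff {α₂ : ℝ} (hα : 0 < α₂) (w : Dom44JCut F Mc k K X) :
    w ∈ Metric.ball (0 : Dom44JCut F Mc k K X) α₂ ↔ val w ∈ recordDom44J F Mc k K X α₂ := by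
  rw [Metric.mem_ball, dist_zero_right, norm_def]
  have h := mem_smul_recordDom44J_iff_gauge_lt F Mc k K X one_pos hα (val w)
  rw [mul_one] at h
  exact h.symm

/-- `ball 0 α₂ = val ⁻¹' recordDom44J … X α₂` (`0 < α₂`). [cite: Balaban1987RG1, (4.4) p.281 (bookkeeping)] -/
theorem ball_zero_eq_preimage {α₂ : ℝ} (hα : 0 < α₂) :
    Metric.ball (0 : Dom44JCut F Mc k K X) α₂ = val ⁻¹' recordDom44J F Mc k K X α₂ :=
  Set.ext fun w => mem_ball_zero_iff hα w

/-- The inclusion is bounded by the norm: `‖val w‖_sup ≤ ‖w‖`. [cite: Balaban1987RG1, (4.4) p.281 (bookkeeping)] -/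
theorem norm_val_le (w : Dom44JCut F Mc k K X) : ‖val w‖ ≤ ‖w‖ := by
  have h := norm_cutTo_le_gauge F Mc k K X one_pos (val w)
  rwa [cutTo_val, one_mul] at h

/-- **The inclusion as a CONTINUOUS linear map** into the sup-normed chart space (operator norm ≤ 1). [cite: Balaban1987RG1, (1.7) p.261 (bookkeeping)] -/
def valCLM : Dom44JCut F Mc k K X →L[ℂ] (Fin (recordChartDimJ F K) → ℂ) :=
  valₗ.mkContinuous 1 fun w => by rw [one_mul]; exact norm_val_le w

/-- `valCLM` evaluates to `val`. [folklore] -/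
@[simp] theorem valCLM_apply (w : Dom44JCut F Mc k K X) : valCLM w = val w := rfl

variable (F Mc k K X) in
/-- **`cut u`** — the vector `cutTo (recordCXJ X) u` as an element of the carrier (how a response `G_k(y)` becomes the `hn n X y` of the Π-holomorphy engine).
[cite: Balaban1987RG1, (4.35) p.290 (bookkeeping)] -/
def cut (u : Fin (recordChartDimJ F K) → ℂ) : Dom44JCut F Mc k K X := ⟨cutTo (recordCXJ F Mc k K X) u, cutTo_mem_cutSubmodule F Mc k K X u⟩

/-- `val (cut u) = cutTo (recordCXJ X) u`. [cite: Balaban1987RG1, (4.35) p.290 (bookkeeping)] -/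
@[simp] theorem val_cut (u : Fin (recordChartDimJ F K) → ℂ) : val (cut F Mc k K X u) = cutTo (recordCXJ F Mc k K X) u := rfl

/-- ★ **THE NORM OF A CUT RESPONSE IN α₂-CURRENCY**: `‖cut u‖ = α₂ · gauge (recordDom44J … α₂) (cutTo (recordCXJ X) u)` — so `Response9D`'s (R1ᴰ)
`gauge … ≤ C₉e^{−δ₀dist}` is `‖hn n X y‖ ≤ (α₂C₉)·e^{−δ₀dist}`, the engine's `hh` with `B₃ := α₂C₉`. [cite: Balaban1987RG1, (4.5) p.282; Balaban1985Variational, (190) p.308] -/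
theorem norm_cut_eq {α₂ : ℝ} (hα : 0 < α₂) (u : Fin (recordChartDimJ F K) → ℂ) :
    ‖cut F Mc k K X u‖ = α₂ * gauge (recordDom44J F Mc k K X α₂) (cutTo (recordCXJ F Mc k K X) u) := by
  rw [norm_eq_mul_gauge hα, val_cut]

/-- The same without the `cutTo` (the gauge does not see the cut). [cite: Balaban1987RG1, (4.5) p.282 (bookkeeping)] -/
theorem norm_cut_eq' {α₂ : ℝ} (hα : 0 < α₂) (u : Fin (recordChartDimJ F K) → ℂ) :
    ‖cut F Mc k K X u‖ = α₂ * gauge (recordDom44J F Mc k K X α₂) u := by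
  rw [norm_cut_eq hα, gauge_recordDom44J_cutTo]

/-- From a gauge row to the engine's norm row: `gauge (D α₂) (cutTo … u) ≤ R ⟹ ‖cut u‖ ≤ α₂·R`. [cite: Balaban1987RG1, (4.5) p.282 (bookkeeping)] -/
theorem norm_cut_le_of_gauge_le {α₂ R : ℝ} (hα : 0 < α₂) {u : Fin (recordChartDimJ F K) → ℂ}
    (h : gauge (recordDom44J F Mc k K X α₂) (cutTo (recordCXJ F Mc k K X) u) ≤ R) : ‖cut F Mc k K X u‖ ≤ α₂ * R := by
  rw [norm_cut_eq hα]; exact mul_le_mul_of_nonneg_left h hα.le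

/-- ★ **ANALYTICITY TRANSPORT, jointly with a coupling parameter**: if `(g, u) ↦ Φ g u` is analytic on `U ×ˢ recordDom44J … X α₂` then
`(g, w) ↦ Φ g (val w)` is analytic on `U ×ˢ ball 0 α₂` — the engine's `han` from `Chart44D`'s chart-analyticity composed with the pieces.
[cite: Balaban1987RG1, (4.4) p.281 with p.266 (analytic alternative)] -/
theorem analyticOnNhd_comp_valCLM {U : Set ℂ} {α₂ : ℝ} (hα : 0 < α₂) {Φ : ℂ → (Fin (recordChartDimJ F K) → ℂ) → ℂ}
    (hΦ : AnalyticOnNhd ℂ (fun p : ℂ × (Fin (recordChartDimJ F K) → ℂ) => Φ p.1 p.2) (U ×ˢ recordDom44J F Mc k K X α₂)) :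
    AnalyticOnNhd ℂ (fun p : ℂ × Dom44JCut F Mc k K X => Φ p.1 (val p.2)) (U ×ˢ Metric.ball 0 α₂) := by
  intro p hp
  have h2 : AnalyticAt ℂ (fun q : ℂ × Dom44JCut F Mc k K X => valCLM q.2) p :=
    ((valCLM (F := F) (X := X)).analyticAt _).comp analyticAt_snd
  have hq : (p.1, valCLM p.2) ∈ U ×ˢ recordDom44J F Mc k K X α₂ := ⟨hp.1, (mem_ball_zero_iff hα p.2).1 hp.2⟩
  exact (hΦ (p.1, valCLM p.2) hq).comp₂ analyticAt_fst h2

/-- Analyticity transport without a parameter: `f` analytic on the (4.4) domain ⟹ `f ∘ val` analytic on the α₂-ball. [cite: Balaban1987RG1, (4.4) p.281 (bookkeeping)] -/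
theorem analyticOnNhd_comp_val {α₂ : ℝ} (hα : 0 < α₂) {f : (Fin (recordChartDimJ F K) → ℂ) → ℂ}
    (hf : AnalyticOnNhd ℂ f (recordDom44J F Mc k K X α₂)) :
    AnalyticOnNhd ℂ (fun w : Dom44JCut F Mc k K X => f (val w)) (Metric.ball 0 α₂) := fun w hw =>
  (hf _ ((mem_ball_zero_iff hα w).1 hw)).comp ((valCLM (F := F) (X := X)).analyticAt w)

/-- A bound on the (4.4) domain is a bound on the α₂-ball (the engine's `h118` from `Chart44D.rowE`'s second conjunct). [cite: Balaban1987RG1, (1.18) p.263 with (4.4) p.281 (bookkeeping)] -/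
theorem bound_on_ball_of_bound_on_dom {α₂ B : ℝ} (hα : 0 < α₂) {f : (Fin (recordChartDimJ F K) → ℂ) → ℂ}
    (hf : ∀ u ∈ recordDom44J F Mc k K X α₂, ‖f u‖ ≤ B) : ∀ w ∈ Metric.ball (0 : Dom44JCut F Mc k K X) α₂, ‖f (val w)‖ ≤ B :=
  fun w hw => hf _ ((mem_ball_zero_iff hα w).1 hw)

end Dom44JCut

end Summit.QuantumFields.YangMills.Theorems.PortU2

end
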